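import Summits.CriticalPhenomena.CardyFormulaZ2.Theorems.ParafermionPrecompact.Negative.ParafermionPrecompactFalseOfBulkNondegenerate
import Summits.CriticalPhenomena.CardyFormulaZ2.Theorems.ParafermionPrecompact.Negative.HeadPassage
import Summits.CriticalPhenomena.CardyFormulaZ2.Theorems.ParafermionFamiliesToSLESix.Negative.CruxModuloBulkNondegenerate
import Summits.CriticalPhenomena.CardyFormulaZ2.Theorems.ParafermionFamiliesToSLESix.Negative.PrecompactIffVanishing
import Summits.CriticalPhenomena.CardyFormulaZ2.Theorems.ParafermionFamiliesToSLESix.Negative.ConclusionNeedsAdmissibility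
import Summits.CriticalPhenomena.CardyFormulaZ2.Theorems.ParafermionFamiliesToSLESix.Negative.ArcConvergenceNotEnough
import Summits.CriticalPhenomena.CardyFormulaZ2.Theorems.CardyComplexConeDefs
import Literature.Barriers.CriticalPhenomena.FKParafermionicHalfCauchyRiemann

/-!
# Line `strip-anchored-vertex-normalisation` for crux `CardySusyWard.ParafermionFamiliesToSLESix` (stmt-CriticalPhenomena-10814)

Skeleton (crux-plan, planner-cruxplan-stmt-CriticalPhenomena-10814-strip-anchored-verte-0, 2026-08-16) of the
crux idea `Cruxes/ParafermionFamiliesToSLESix/Ideas/strip-anchored-vertex-normalisation.md` (crux-ideate r1,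
ideator 2; triage r1-1/2/3: pass ×3, "with reservations"), with the triage sharpenings and the standing
disprover's findings built in.

THE ITEM AS TYPED. `ParafermionFamiliesToSLESix := WeakHolomorphy → ParafermionPrecompact → AllFamiliesSLE6`.
The landed negative lemmas of the sibling crux (`Theorems/ParafermionPrecompact/Negative/…`, imported here) prove
`ParafermionPrecompact ↔ (δ^{-1/3} F_δ → 0 uniformly on compacts, for every Dobrushin domain and every admissible
family)` (`parafermionPrecompact_iff_vanishing`; junk `Sym2` twins), so the typed item is `H ∨ conjecture` with
`H = ParafermionBulkNondegenerate` (Disproof.lean `crux_iff_bulkNondegenerate_or_conjecture`). THIS LINE PROVES THE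
`H`-BRANCH: from six stubs it derives that the second hypothesis `ParafermionPrecompact` is contradictory, i.e. it
proves bulk non-degeneracy of the `q = 1` parafermion at the Duminil-Copin–Smirnov scale `δ^{1/3}` on ONE anchor
domain — the statement every SLE line of the REPAIRED crux needs as its non-degeneracy input N (item why-might-fail:
"no non-degeneracy (lim ≠ 0) hypothesis") and the statement that turns the negative-lemma hold on 11293 into a
refutation. No SLE content is booked to this line (triage r1-1 (4), r1-3 (1)): its deliverable is N.

THE LINE (wall anchor ⇒ bulk, by flux conservation of the half-Cauchy–Riemann form).
* `stub_vertexCornerBridge` (S1, exact, provable now): off the two `A`–`B` edges,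
  `2cos(π/12) · F_E(z) = Σ_{the four corners c at z} cornerObs E (c)` — each passage through `z` arrives along one
  medial edge (winding `W`) and leaves along another (`W ± π/2`), and `windingAt` is their average. Makes the VERTEX
  observable of this crux the `m = 0` (isotropic) class component of the CORNER (dart) field.
* `stub_halfCRVertexRelation` (S2, exact, provable now; = support item CardySublatticeCoherence.HalfCRVertexRelation,
  stmt-11306, restated over the barrier file's `HalfCRRelationAt`/`medialCornersAt`): at every interior medial vertex
  `G(NW) − G(SE) = χ (G(NE) − G(SW))`, `χ ∈ {i, −i}` (Duminil-Copin 2012 Prop. 4 for the tree's objects). With the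
  barrier's Green identity `sum_halfCRForm_eq_halfCRFlux` this is flux conservation of the corner field.
* `stub_uniformInnerEnvelope` (S3 = `UniformInnerEnvelope` of `Theorems/CardyComplexConeDefs.lean` BY NAME — the card's
  kernel UB, shared verbatim with line `qkz-strip-boundary-arm` of crux 11387, where it is (T)+(P)): one `C` with
  `‖cornerObs‖ ≤ C · (lattice depth)^{-1/3}` in every admissible discretisation of every Jordan Dobrushin domain.
* `stub_staggeredModeBound` (S4, HARDEST, the input the card's caution (4) foresaw): on compacts, eventually,
  `‖G(NW) − G(NE) + G(SE) − G(SW)‖ ≤ ε δ^{1/3}` — the darts along one lattice diagonal and along the other carry the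
  same observable to `o(δ^{1/3})`. This is the asymptotic SUM RELATION (the missing half of discrete Cauchy–Riemann,
  Kenyon CR of the stream function) in pointwise form; exact enumeration (n = 3) shows it is NOT an identity, Monte-Carlo
  of crux 11293 (MC-EVIDENCE-ideator2) shows the defect at ≤ 0.1 % of `|F|` and decaying in the depth; physically it is
  the spin-`(σ−2) = −5/3` component, winding-phase gain `25/12 ≫ 1/12`.
* `stub_anchoredWallFlux` (S5, the STRIP ANCHOR, ∃-form): some Dobrushin domain with a straight piece of free boundary
  (the long DIAGONAL rectangle of Ikhlef–Ponsaing's strip), some admissible family, and every thin box over a window of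
  that wall have wall flux `‖wallFlux‖ ≥ c δ^{-2/3}`: per wall site the two boundary corners of a touch carry
  `−χ P(w ↔ A) e^{-iW₁/3}(1 + e^{-iπ/3})` (deterministic phase, cone factor `√3 ≠ 0` — never anti-aligned), and
  `P(w ↔ A) ≥ c' δ^{1/3}` is the lower half of IP12 Prop. 4.9 (`P_b(L) = A_V(L)A_V(L+2)/N_8(L+1)² ∼ 1.137 L^{-1/3}`,
  `ipRatio`, `wallConn` of CardyComplexConeDefs; = qkz line's `stub_ipExact` + elementary asymptotics + RSW gluing).
* `stub_fluxPropagation` (S6, the contour argument): Green identity on the interior vertices between the wall window and an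
  axis-parallel macroscopic-step staircase at depth `h…2h`: `wallFlux = −openFlux`; transversals cost `C(h/δ)^{2/3}` by
  UB; on straight axis pieces the flux functional `λ = (1,−χ,0,0)` decomposes EXACTLY as
  `λ = (1−χ)/4·𝟙 + ½·ν + (1+χ)/4·μ` (𝟙 = vertex sum = `2cos(π/12)F` by S1, `ν` = half-CR form = 0 by S2, `μ` = staggered
  combination of S4), so under VERTEX VANISHING (the typed hypothesis) and S4 the bulk side is `o(δ^{-2/3})`; the `O(r/h)`
  staircase corners cost `O(δ^{1/3} h^{-1/3})` each by UB. Hence `‖wallFlux‖ ≤ η δ^{-2/3}` eventually, for every `η`.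
* `ParafermionFamiliesToSLESix_of`: the kernel-checked composition — `hP : ParafermionPrecompact` gives vertex vanishing
  on the anchor family (`parafermionPrecompact_iff_vanishing`), S6 makes the anchor's wall flux `≤ (c/2) δ^{-2/3}`,
  S5 makes it `≥ c δ^{-2/3}`: contradiction, so the typed implication holds.

Disproof.lean (cdisprove cycle 1, `Cruxes/ParafermionFamiliesToSLESix/Disproof.lean`, read in full) — honoured:
`crux_iff` / `parafermionPrecompact_iff_vanishing` / `crux_of_not_vanishing` / `crux_of_bulkNondegenerate` (this line IS
branch (ii) "refuting Vanishing = proving a δ^{1/3} lower bound somewhere", made into a skeleton; the Negative lemma is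
imported, not re-proved; the line's deliverable `bulkNondegenerate_of` is `H` itself, and `ParafermionFamiliesToSLESix_of`
is `H`'s consequence); `not_conclusionWithoutAdmissibility` / `…WithoutMarksAndAdmissibility` (S4–S6 quantify over
`IsFamily` = all six family fields; the anchor of S5 is a genuine admissible family); `hypotheses_satisfiable_unitDisc`
(∃-form of S5 is not threatened by vacuity). No `_false_without_` theorem and no Target stub exist yet (`stuck_stubs = []`).
The LANDED Negative lemmas of both sibling cruxes are imported above and no stub is an instance of any of them:
`Negative/PrecompactIffVanishing` + `Negative/CruxModuloBulkNondegenerate` (USED: the typed collapse and `crux ↔ H ∨ conj`),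
`Negative/ConclusionNeedsAdmissibility` + `Negative/ArcConvergenceNotEnough` (dropped side conditions — kept here),
`ParafermionPrecompact/Negative/HeadPassage` (`‖F_δ(e_a)‖ = 1`: clause (i) fails on `closure Ω` — every envelope / vanishing
statement below is on compacts INSIDE `Ω` or at lattice depth `R ≥ 1` with a free constant, consistent with `‖cornerObs‖ ≤ 1`
at the start corner). `ledger negatives --problem CriticalPhenomena`: no stub is an instance (every lattice quantifier is
over genuine interior medial vertices / `IsFamily`, eventually in `δ` — the 0772/6949 lessons).
-/

namespace Summit.CriticalPhenomena.CardyFormulaZ2.Cruxes.ParafermionFamiliesToSLESix.StripAnchoredVertexNormalisation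

open MeasureTheory Filter Set Metric
open scoped Topology BigOperators
open Literature.Probability.LatticeModels (DiscreteDobrushin MedialVertex Site medialPoint medialExploration IsCorner
  zdGraph discreteDomainGraph)
open Literature.Probability.Percolation (bondPercolation half BondConfig)
open Literature.Probability.RandomPlanarGeometry (DobrushinDomain)
open Literature.Barriers.CriticalPhenomena (medialCornersAt medialVertexOf HalfCRRelationAt halfCRFlux halfCRForm)
open Literature.Barriers.CriticalPhenomena.HalfCRGreen (coeff twin)
open Summit.CriticalPhenomena.CardyFormulaZ2.Theses.CardySusyWard
open Summit.CriticalPhenomena.CardyFormulaZ2.Theorems.ParafermionPrecompact.Negative (F IsFamily VanishesOn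
  parafermionPrecompact_iff_vanishing parafermionPrecompact_iff_not_bulkNondegenerate)
open Literature.Probability.LatticeModels (ParafermionBulkNondegenerate)
open Summit.CriticalPhenomena.CardyFormulaZ2.Cruxes.EdgePrecompact.QkzStripBoundaryArm (cornerObs UniformInnerEnvelope)

set_option linter.unusedVariables false

noncomputable section

/-! ## Vocabulary -/

/-- The spin-`1/3` VERTEX observable of the exploration path of the discrete Dobrushin data `E`, read at mesh `δ`, at
the medial vertex `z`: `∫ passageSum (medialExploration E ω) δ (1/3) z dP_{1/2}` — VERBATIM the integrand of the route's
`WeakHolomorphy` / `ParafermionPrecompact` (there `E = Λ δ`), and definitionally the `F Λ δ z` of the imported Negative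
lemma file (`F_eq_vertexObs`). -/
def vertexObs (E : DiscreteDobrushin) (δ : ℝ) (z : MedialVertex) : ℂ :=
  ∫ ω, Literature.Probability.LatticeModels.MedialPath.passageSum (medialExploration E ω) δ (1 / 3) z
    ∂(bondPercolation (zdGraph 2) half)

/-- `F Λ δ z` of the Negative lemma file IS `vertexObs (Λ δ) δ z` (by `rfl`). -/
theorem F_eq_vertexObs (Λ : ℝ → DiscreteDobrushin) (δ : ℝ) (z : MedialVertex) :
    F Λ δ z = vertexObs (Λ δ) δ z := rfl

/-- The spin-`1/3` CORNER observable at the `k`-th corner (medial edge) of the medial vertex `s(x, x + eᵢ)`, `p = (x, i)`,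
corners listed clockwise `NW, NE, SE, SW` by the barrier file's certified table `medialCornersAt`; `cornerObs` is the
corner observable of `Theorems/CardyComplexConeDefs.lean` (sum over the traversals of the oriented medial edge of
`exp (−(i/3)·winding of the polyline prefix ending with it)`, expectation under `P_{1/2}`). -/
def G (E : DiscreteDobrushin) (δ : ℝ) (p : Site 2 × Fin 2) (k : Fin 4) : ℂ :=
  cornerObs E δ (medialCornersAt p.1 p.2 k).1 (medialCornersAt p.1 p.2 k).2

/-- `p = (x, i)` indexes an INTERIOR medial vertex of `E`: the lattice edge `s(x, x + eᵢ)` is an edge of `Ω_δ`, has no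
endpoint on the discrete arcs, and both faces containing it are inner faces (the hypotheses of the half-CR vertex
relation, as in support item stmt-11306; eventually true for every medial vertex over a compact `K ⊂ Ω`). -/
def IsInteriorMV (E : DiscreteDobrushin) (p : Site 2 × Fin 2) : Prop :=
  medialVertexOf p ∈ (discreteDomainGraph E.Ω E.δ).edgeSet ∧
  (∀ x ∈ medialVertexOf p, x ∉ E.zdArcA ∧ x ∉ E.zdArcB) ∧
  ∀ f : Site 2, IsCorner p.1 f → IsCorner (p.1 + Pi.single p.2 1) f → E.IsInnerFace f

/-- The STAGGERED (sum-relation) combination of the four corner observables at `p`: `G(NW) − G(NE) + G(SE) − G(SW)`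
= (darts along one lattice diagonal) − (darts along the other). Its vanishing is the "sum relation", the missing half of
the discrete Cauchy–Riemann equations; it is NOT a lattice identity (exact enumeration, n = 3). -/
def stagger (E : DiscreteDobrushin) (δ : ℝ) (p : Site 2 × Fin 2) : ℂ :=
  G E δ p 0 - G E δ p 1 + G E δ p 2 - G E δ p 3

open Classical in
/-- The WALL FLUX of the corner field of `E` (read at mesh `δ`, half-CR coefficient `χ`) out of the window `U`: the sum,
over the interior medial vertices `p` with `medialPoint δ p ∈ U` and over their corners whose other medial vertex
(`HalfCRGreen.twin`) is NOT interior (a wall-adjacent medial vertex), of `coeff χ k · G(p, k)` — the wall part of the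
barrier file's boundary flux `halfCRFlux χ S` of `S = {interior p in U}`; for a box `U` straddling a straight piece of the
boundary these are exactly the boundary corners of the touches of the interface at that piece of wall. (Finite sum for
bounded `Ω`; `finsum` junk `0` otherwise.) -/
def wallFlux (χ : ℂ) (E : DiscreteDobrushin) (δ : ℝ) (U : Set ℂ) : ℂ :=
  ∑ᶠ p : Site 2 × Fin 2,
    if IsInteriorMV E p ∧ medialPoint δ (medialVertexOf p) ∈ U then
      ∑ k : Fin 4, (if IsInteriorMV E (twin p.1 p.2 k) then 0 else coeff χ k * G E δ p k)
    else 0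

/-- `LocalHalfPlane D w₀ n r`: near the boundary point `w₀` the Dobrushin domain `D` is EXACTLY a half-plane with inward
unit normal `n`, on the ball of radius `4r`: `z ∈ Ω ↔ 0 < Re((z − w₀)·n̄)` for `|z − w₀| < 4r`. (A straight piece of
wall: a side of a polygon, axis-parallel or diagonal or of any slope.) -/
def LocalHalfPlane (D : DobrushinDomain) (w₀ n : ℂ) (r : ℝ) : Prop :=
  ‖n‖ = 1 ∧ 0 < r ∧ ∀ z ∈ ball w₀ (4 * r), z ∈ D.carrier ↔ 0 < ((z - w₀) * (starRingEnd ℂ) n).re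

/-- The thin box over the wall window: tangential coordinate `|Re((z − w₀)·conj(i n))| < r`, normal coordinate
`|Re((z − w₀)·n̄)| < h` (it sticks out of the domain below the wall, harmlessly). -/
def wallBox (w₀ n : ℂ) (r h : ℝ) : Set ℂ :=
  {z | |((z - w₀) * (starRingEnd ℂ) (Complex.I * n)).re| < r ∧ |((z - w₀) * (starRingEnd ℂ) n).re| < h}

/-! ## The statements of the line -/

/-- (S1) VERTEX–CORNER BRIDGE. For admissible data `E`, every medial vertex `z = s(x, x + eᵢ)` other than the two `A`–`B`
edges, and every reading mesh `δ > 0`: `2cos(π/12) · vertexObs E δ z = Σ_{k<4} G E δ (x,i) k`. -/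
def VertexCornerBridge : Prop :=
  ∀ (E : DiscreteDobrushin), E.IsZdAdmissible → ∀ p : Site 2 × Fin 2, medialVertexOf p ∉ E.zdABEdges →
    ∀ δ : ℝ, 0 < δ →
      ((2 * Real.cos (Real.pi / 12) : ℝ) : ℂ) * vertexObs E δ (medialVertexOf p) = ∑ k : Fin 4, G E δ p k

/-- (S2) HALF-CR VERTEX RELATION with coefficient `χ` for the tree's corner observable: at every interior medial vertex of
admissible data, `G(NW) − G(SE) = χ (G(NE) − G(SW))` (= `HalfCRRelationAt χ` of the barrier file). -/
def HalfCRVertexRelation (χ : ℂ) : Prop :=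
  ∀ (E : DiscreteDobrushin), E.IsZdAdmissible → ∀ p : Site 2 × Fin 2, IsInteriorMV E p →
    ∀ δ : ℝ, 0 < δ → HalfCRRelationAt χ (fun c : Site 2 × Site 2 => cornerObs E δ c.1 c.2) p

/-- (S4's content) STAGGERED VANISHING along the family `Λ` of `D`: on every compact `K ⊂ Ω`, for every `ε > 0`, eventually
in `δ`, `‖stagger (Λ δ) δ p‖ ≤ ε δ^{1/3}` for every medial vertex over `K`. -/
def StaggeredVanishes (D : DobrushinDomain) (Λ : ℝ → DiscreteDobrushin) : Prop :=
  ∀ K : Set ℂ, IsCompact K → K ⊆ D.carrier → ∀ ε > (0:ℝ), ∀ᶠ δ in 𝓝[>] (0:ℝ),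
    ∀ p : Site 2 × Fin 2, medialPoint δ (medialVertexOf p) ∈ K → ‖stagger (Λ δ) δ p‖ ≤ ε * δ ^ ((1:ℝ) / 3)

/-- VERTEX VANISHING along the family `Λ` of `D` (the degenerate normalisation `δ^{-1/3} F_δ → 0` on compacts): literally
`VanishesOn Λ K` of the Negative lemma file for every compact `K ⊂ Ω` — what the typed hypothesis `ParafermionPrecompact`
says (`parafermionPrecompact_iff_vanishing`). A HYPOTHESIS of S6, never a stub. -/
def VertexVanishes (D : DobrushinDomain) (Λ : ℝ → DiscreteDobrushin) : Prop :=
  ∀ K : Set ℂ, IsCompact K → K ⊆ D.carrier → VanishesOn Λ K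

/-- (S5) ANCHORED WALL FLUX (the strip anchor, ∃-form): some Dobrushin domain `D`, some family `Λ` with the six family
fields (`IsFamily`), some straight piece of wall (`LocalHalfPlane D w₀ n r`) and some `c > 0` such that, for both
admissible coefficients `χ = ±i` and every box height `0 < h < r`, eventually in `δ`:
`c · δ^{-2/3} ≤ ‖wallFlux χ (Λ δ) δ (wallBox w₀ n r h)‖`. -/
def AnchoredWallFlux : Prop :=
  ∃ (D : DobrushinDomain) (Λ : ℝ → DiscreteDobrushin), IsFamily D Λ ∧
    ∃ (w₀ n : ℂ) (r : ℝ), LocalHalfPlane D w₀ n r ∧ ∃ c : ℝ, 0 < c ∧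
      ∀ χ : ℂ, (χ = Complex.I ∨ χ = -Complex.I) → ∀ h : ℝ, 0 < h → h < r →
        ∀ᶠ δ in 𝓝[>] (0:ℝ), c * δ ^ (-(2:ℝ) / 3) ≤ ‖wallFlux χ (Λ δ) δ (wallBox w₀ n r h)‖

/-- (S6) FLUX PROPAGATION (the contour argument): for `χ = ±i` with the half-CR relation, the bridge and the uniform inner
envelope, along any family `Λ` of any `D` on which the staggered combination AND the vertex observable vanish at scale
`δ^{1/3}` on compacts, the wall flux through every straight piece of wall is `o(δ^{-2/3})`: for every `η > 0` there is a
box height `h ∈ (0, r)` with `‖wallFlux χ (Λ δ) δ (wallBox w₀ n r h)‖ ≤ η δ^{-2/3}` eventually in `δ`. -/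
def FluxPropagation : Prop :=
  ∀ χ : ℂ, (χ = Complex.I ∨ χ = -Complex.I) → HalfCRVertexRelation χ → VertexCornerBridge →
    UniformInnerEnvelope → ∀ (D : DobrushinDomain) (Λ : ℝ → DiscreteDobrushin), IsFamily D Λ →
      StaggeredVanishes D Λ → VertexVanishes D Λ → ∀ (w₀ n : ℂ) (r : ℝ), LocalHalfPlane D w₀ n r →
        ∀ η > (0:ℝ), ∃ h : ℝ, 0 < h ∧ h < r ∧
          ∀ᶠ δ in 𝓝[>] (0:ℝ), ‖wallFlux χ (Λ δ) δ (wallBox w₀ n r h)‖ ≤ η * δ ^ (-(2:ℝ) / 3)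

/-! ## The stubs -/

/-- **(S1) `stub_vertexCornerBridge` — exact lattice identity (M; provable now).**
`2cos(π/12) · vertexObs E δ z = Σ_{k<4} cornerObs E δ (medialCornersAt x i k)` for admissible `E`, every medial vertex
`z = s(x, x+eᵢ) ∉ zdABEdges` and every reading mesh `δ > 0`.
Why true: pathwise for `γ = medialExploration E ω` (junk `[]`: both sides `0`; otherwise `IsMedialExploration`): a passage
of `γ` through `z` at position `k` has `0 < k < |γ| − 1` (positions `0`, `|γ|−1` are the two `A`–`B` edges, `head_mem`,
`getLast_mem`, `ncard_zdABEdges_eq_two`), its arriving dart `(γ[k−1], γ[k])` and departing dart `(γ[k], γ[k+1])` are medial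
steps, i.e. corners with target resp. source `z`, hence entries of `medialCornersAt x i` (`cornerEdge_medialCornersAt` +
`IsCorner.eq_of_cornerSource_eq_of_cornerTarget_eq_holds`), traversed at THAT position (darts are not repeated: `nodup`);
conversely every traversal of one of the four corners is an arrival at or a departure from `z`. By `IsMedialTurn` the
departure winding is the arrival winding `± π/2`, and `windingAt γ δ k` is their average `W`, so the passage contributes
`e^{-i(W−π/4)/3} + e^{-i(W+π/4)/3} = 2cos(π/12) e^{-iW/3}` to the right-hand side (`Polyline.winding` of the `take (k+1)` /
`take (k+2)` prefixes; `Complex.exp` algebra; or, via `FermionicObservableSums.medialExploration_eq_explorationList` /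
`passageSum_explorationList` / `quarterPhase_turnCount`, as an identity between quarter-turn phases along the cut orbit). Integrate: the integrands are bounded (a medial vertex is passed at most twice)
and measurable (the exploration of a bounded admissible domain depends on finitely many edges: cylinder fibres) —
this measurability lemma is part of the stub. Verified independently by all three triagers (r1-1, r1-2 to 1e-12, r1-3) and
it is the `VertexDartSplit` of the sibling crux 11293 (four-class line). Size M. -/
theorem stub_vertexCornerBridge : VertexCornerBridge := by
  sorry

/-- **(S2) `stub_halfCRVertexRelation` — Duminil-Copin 2012 Prop. 4 / DCS 2012 Prop. 8.6 for the tree's objects (M–L;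
provable now; = support item `CardySublatticeCoherence.HalfCRVertexRelation`, stmt-11306, up to unfolding its inlined
winding/corner tables into `cornerObs`/`medialCornersAt`).** There is a universal `χ ∈ {i, −i}` such that for every
ℤ²-admissible `E`, every interior medial vertex `p` (`IsInteriorMV`: edge of `Ω_δ`, no endpoint on the arcs, both faces
inner) and every `δ > 0`: `G(NW) − G(SE) = χ (G(NE) − G(SW))`.
Why true: the edge-flip involution `ω ↦ ω Δ {z}` preserves `P_{1/2}` and pairs the configurations in which the interface
reaches `z`; comparing the (at most two) passages through `z` in `ω` and in `ω Δ {z}` and their windings (`±π/2` turns,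
spin `1/3`: `e^{∓iπ/6}` factors) gives the four-term relation — DC 2012 Prop. 4 (arXiv:1208.3787 p. 8), DCS 2012 Prop. 8.6
(arXiv:1109.1549); which sign `χ` is the tree's (orientation `v` on the left, clockwise corner table, winding sign) is
decided inside the proof (crux-11293 MC: exact to 1e-11 with one sign at every vertex with two in- and two out-darts).
Needs the same measurability lemma as S1 and `isMedialExploration_medialExploration`-type facts for admissible data.
Cheapest falsifier: exact enumeration n = 3 (done by crux 11293 ideator 2: holds to 1e-11). Size M–L. -/
theorem stub_halfCRVertexRelation : ∃ χ : ℂ, (χ = Complex.I ∨ χ = -Complex.I) ∧ HalfCRVertexRelation χ := by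
  sorry

/-- **(S3) `stub_uniformInnerEnvelope` — the card's kernel UB = `UniformInnerEnvelope` of CardyComplexConeDefs BY NAME
(XL; THE envelope bet, shared verbatim with line `qkz-strip-boundary-arm` of crux stmt-11387, where it is proved from its
stubs (T) `stub_twistedComparison` + (P) `stub_ipExact`/`stub_ipAsymptotic`/`stub_halfArm_le_strip`).** One constant `C`:
for every Jordan Dobrushin domain `D`, every admissible `E` with `E.Ω = D.carrier`, every corner `(v,f)` at lattice depth
`R ≥ 1` (`R·δ ≤ dist(δv, Dᶜ)`): `‖cornerObs E E.δ v f‖ ≤ C R^{-1/3}`.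
Why plausibly true: it is Koebe distortion for the conjectured limit (`|f| = |c (φ′)^{1/3}| ≤ 2^{1/3}|c| d^{-1/3}` since
`|φ′(z)| d(z) ≤ 2 dist(φ(z), ∂S)` for the conformal map onto the strip) pushed down to the lattice scale: at depth `R` the
corner observable is a dimension-`1/3` quantity `≲` the half-plane one-arm probability to distance `R` (IP12: `≍ R^{-1/3}`
on the diagonal); trivially true for small `R` (`‖cornerObs‖ ≤ 1`). Why it might fail: the signed `δ^{1/12}` cancellation
beyond the two-arm bound `(δ/d)^{1/4}` must hold UNIFORMLY down to mesoscopic depths (NOTES S2 of the crux: needed exactly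
on depths `[δ^{1/13}, η]`); numerically the envelope is flat at a flat wall down to the first interior row (MC j009613:
`δ^{-1/3}‖F‖` = 1.40 ± 2 % at every height). This line consumes it only on the anchor rectangle, along transversals and
at `O(r/h)` staircase corners. -/
theorem stub_uniformInnerEnvelope : UniformInnerEnvelope := by
  sorry

/-- **(S4) `stub_staggeredModeBound` — the asymptotic SUM RELATION, pointwise on compacts (XL; HARDEST; NEW — the input the
card's caution (4) asked for).** Along every family `Λ` of every `D` (six family fields), on every compact `K ⊂ Ω`:
`‖G(NW) − G(NE) + G(SE) − G(SW)‖ ≤ ε δ^{1/3}` eventually, at every medial vertex over `K`.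
Why plausibly true: (a) class Fourier analysis of the dart field at a vertex: `G_k = Σ_m c_m e^{-imθ_k}` over the four
dart directions, and `Σ_{darts at z} e^{imθ} e^{-iσW} = e^{imθ₀} Σ e^{-i(σ−m)W}` pathwise, so `c_m` is the spin-`(σ−m)`
parafermion at `z`; the staggered combination is `4c_2`, spin `−5/3`, whose winding-phase cancellation exponent is
`(5/3)²κ/8 = 25/12` against the `1/12` of spin `1/3`: predicted size `δ^{1/4+25/12} = δ^{7/3} ⋘ δ^{1/3}`; (b) NUMERICS (crux
11293, MC-EVIDENCE-ideator2, tree conventions): window-averaged `|Σ|/max|G|` = .0017(34), .0016(27), .0017(20), .0011(15)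
at n = 24, 32, 48, 64; per-vertex `|mean Σ|/|F|` = 1.0e-3, 3.5e-4, 2.3e-4, 7.4e-4 at n = 16–48; exact n = 3: NOT an identity
(1.3–1.8 % of `max|F|` at depth 1.5), defect decaying in the depth `(δ/d)^p`, `p ∈ [0.7, 2]`; (c) it is the pointwise form of
"the other half becomes satisfied in the scaling limit" (DC 2013 p. 158; barrier file, Narrow form (b)); on THIS route it is
what `QExactPlaquette` (stmt-6803) is designed to give (the plaquette circulation = this combination is `Q`-exact, a lattice
divergence of envelope-bounded quantities). Relation to the route's crux X1 (`WeakHolomorphy`, rank 2): by the exact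
decomposition of S6, closed-contour sums of the staggered field equal `−κ ×` discrete contour integrals of the VERTEX
observable, so X1 is the closed-contour/weak form of this statement and S4 ⇒ X1 on `(D, Λ)` given UB; S4 is STRONGER
(pointwise) — honest label: open, of the calibre of X1, but with a `δ²` margin instead of X1's `δ^{1/12}`. Why it might fail:
only if the leading class vector of the dart field had a staggered admixture `iβ(1,−1,1,−1)` (allowed by half-CR, by equal
class moduli and by the mirror symmetry; excluded by the spin law and by the per-vertex MC at the 1e-3 level). Only
cut-AVERAGES over straight axis segments in the bulk of ONE anchor rectangle are consumed (S6). -/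
theorem stub_staggeredModeBound :
    ∀ (D : DobrushinDomain) (Λ : ℝ → DiscreteDobrushin), IsFamily D Λ → StaggeredVanishes D Λ := by
  sorry

/-- **(S5) `stub_anchoredWallFlux` — THE STRIP ANCHOR (L given the qkz line's `stub_ipExact`; XL stand-alone).** There exist
`D`, an `IsFamily` family `Λ`, a straight piece of wall `LocalHalfPlane D w₀ n r` and `c > 0` with
`c δ^{-2/3} ≤ ‖wallFlux χ (Λ δ) δ (wallBox w₀ n r h)‖` eventually, for `χ = ±i` and every `0 < h < r`.
Why plausibly true (the witness): `D` = a long DIAGONAL rectangle (sides along the lattice diagonals; marks at the midpoints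
of the short sides; = a window of Ikhlef–Ponsaing's wired/free strip of the medial lattice), `Λ` = its standard admissible
discretisation (straight staircase walls, arcs tilted at the four corners so that no boundary site ties; template
`UnitDiscDiscretisation`), `w₀` = midpoint of the free long side, `n` = the inward diagonal normal. H21 rendering
(`bcBondConfig` closes every edge at a `zdArcB` site; along a diagonal free wall at level `L` the sites of levels `L−1, L`
are arc-`B` sites, interior sites have level `≤ L−2`): a touch of the interface at the wall site `w` (level `L−2`) is the dart
triple `S→E`, `E→N`, `N→W` around `w` (`E = s(w,w+e₀)`, `N = s(w,w+e₁)` the closed wall edges), present iff `w ↔ A`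
(`TouchModulus`, DC 2012 Prop. 5: `w` on the left of the interface iff joined to the wired arc); its two FLUX corners are
`S→E` (corner `NE` of the interior vertical vertex `S` below `w`) and `N→W` (corner `NE` of the interior horizontal vertex
`W` left of `w`), both with coefficient `−χ`, windings `W₁` and `W₁ + π` (`E→N` joins two wall vertices and is not a flux
corner); `W₁` is deterministic and the same for every `w` along the straight wall (`TouchPhase`). Hence
`wallFlux = −χ e^{-iW₁/3}(1 + e^{-iπ/3}) Σ_{w in the window} P(w ↔ A)`, cone factor `|1 + e^{-iπ/3}| = √3 ≠ 0` for BOTH signs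
of `χ` (never anti-aligned — card falsifier (a), re-checked by triager 2 for every angle convention: factors ∈ {1, √3, √2}),
and `‖wallFlux‖ = √3 Σ_w P(w ↔ A) ≥ √3 · (r/δ) · c′ δ^{1/3}` from the wall-touch LOWER bound `P(w ↔ A) ≥ c′ δ^{1/3}`:
Ikhlef–Ponsaing 2012 (arXiv:1202.5476) Props 4.5/4.7/4.9, `P_b(L) = A_V(L)A_V(L+2)/N_8(L+1)² ∼ 1.137 L^{-1/3}` (lower half of
the asymptotics of `ipRatio`; exact value = qkz line's `stub_ipExact` over `wallConn`), transported from the infinite strip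
to the rectangle by RSW/FKG gluing (connection to the opposite wired side inside the `W × W` square around `w` costs a
constant). Why it might fail: only through the rigour of IP12's Perron/qKZ identification (triage r1-1 (1), r1-2 (1): "one
can show … [dGP07]"; certifiable per width by exact transfer matrices) — the flux bookkeeping is finite and checked; an
axis-parallel anchor would instead need the sharp axis half-plane one-arm LOWER bound (no integrable handle; MC j009613 gives
wall passage `0.95 N^{-1/3}`). -/
theorem stub_anchoredWallFlux : AnchoredWallFlux := by
  sorry

/-- **(S6) `stub_fluxPropagation` — the contour argument (L).** See `FluxPropagation`.
Why true (the bookkeeping, all errors explicit): fix `χ, D, Λ, w₀, n, r, η`. Eventually in `δ` the data `E = Λ δ` are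
admissible with `E.Ω = D.carrier`, `E.δ = δ`. Let `S′` be the finite set of interior medial vertices `p` with tangential
coordinate `|s| < r` and normal coordinate `0 < t < σ(s)`, `σ` an axis-parallel LATTICE STAIRCASE with `O(r/h)` steps
between depths `h` and `2h` (for an axis-parallel wall: the straight cut `t = h`). Green (`sum_halfCRForm_eq_halfCRFlux`) and
S2 at every `p ∈ S′`: `halfCRFlux χ S′ G = 0`. Its boundary corners are: (w) those into NON-interior vertices — exactly the
summands of `wallFlux χ E δ (wallBox w₀ n r h)` (wall-adjacent vertices lie within `O(δ)` of the wall, `LocalHalfPlane` makes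
the discrete domain near `w₀` the canonical half-plane staircase, and `S′` agrees with the box below depth `h`); (t) those
across the two transversals `|s| = r`, `0 < t < 2h`: by S3 (depth to `Dᶜ` = `t` inside `ball(w₀, 2r)`) at most
`Σ_{j ≤ 2h/δ} O(1)·C j^{-1/3} + O(1) ≤ C′(h/δ)^{2/3}`; (b) those across the staircase: on each straight axis piece the
boundary-corner set of every boundary vertex is {`NW`,`NE`} (horizontal pieces, either vertex type) or {`NE`,`SE`} /
{`SW`,`NW`} (vertical pieces), and the corresponding functionals decompose EXACTLY (checked for every `χ`):
`(1,−χ,0,0) = (1−χ)/4·(1,1,1,1) + ½·(1,−χ,−1,χ) + (1+χ)/4·(1,−1,1,−1)`,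
`(0,−χ,−1,0) = −(1+χ)/4·(1,1,1,1) + ½·(1,−χ,−1,χ) + (χ−1)/4·(1,−1,1,−1)`;
the middle term is `0` by S2, the first is `(1∓χ)/4 · 2cos(π/12)·vertexObs` by S1 — at depth `∈ [h, 2h]`, i.e. over the
compact `K_h = {|s| ≤ r, h/2 ≤ t ≤ 3h} ⊂ Ω`, hence `≤ ε₁ δ^{1/3}` by `VertexVanishes` — and the last is `≤ ε₂ δ^{1/3}` by
`StaggeredVanishes` on `K_h`; the `O(r/h)` staircase corners carry `O(1)` irregular corners each, every one
`≤ C (δ/h)^{1/3}` by S3. Total: `‖wallFlux‖ = ‖(t) + (b)‖ ≤ C′ h^{2/3} δ^{-2/3} + C″(r/δ)(ε₁ + ε₂) δ^{1/3} + C‴(r/h) h^{-1/3} δ^{1/3}`;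
choose `h < r` with `C′h^{2/3} ≤ η/3`, then `ε₁, ε₂` with `C″ r (ε₁+ε₂) ≤ η/3`; the last term is `≤ (η/3) δ^{-2/3}` eventually.
Ingredients beyond S1–S4: finiteness of `S′` (bounded `Ω`), the lattice geometry of `wallBox`/staircases (multiplicity `O(1)`
of corners per depth layer on a transversal), `medialCornersAt_twin`/`eq_twin_of_medialCornersAt_eq` (each medial edge has
exactly two medial vertices), and `infDist` to `Dᶜ` = normal coordinate near a straight wall. Why it might fail: it does
not, given its hypotheses (all estimates have room); the risk of the line sits in S3–S5. Size L (Finset bookkeeping heavy). -/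
theorem stub_fluxPropagation : FluxPropagation := by
  sorry

/-! ## The composition (kernel-checked, no `sorry` of its own) -/

/-- **The six stubs contradict the typed second hypothesis.** `hP : ParafermionPrecompact` is, by the landed negative
lemma `parafermionPrecompact_iff_vanishing`, vertex vanishing along EVERY family — in particular along the anchor family
of S5 (`VertexVanishes`); S4 gives staggered vanishing there; S6 (fed S1, S2's `χ`, S3) then makes the anchor's wall flux
`≤ (c/2) δ^{-2/3}` eventually for some box height `h ∈ (0,r)`, while S5 makes it `≥ c δ^{-2/3}` eventually for that `h`;
at a common small `δ > 0` this is absurd (`δ^{-2/3} > 0`, `c > 0`). -/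
theorem false_of_stubs_of_parafermionPrecompact
    (hBridge : VertexCornerBridge)
    (hCR : ∃ χ : ℂ, (χ = Complex.I ∨ χ = -Complex.I) ∧ HalfCRVertexRelation χ)
    (hUB : UniformInnerEnvelope)
    (hStag : ∀ (D : DobrushinDomain) (Λ : ℝ → DiscreteDobrushin), IsFamily D Λ → StaggeredVanishes D Λ)
    (hAnchor : AnchoredWallFlux) (hProp : FluxPropagation) (hP : ParafermionPrecompact) : False := by
  obtain ⟨χ, hχ, hcr⟩ := hCR
  obtain ⟨D, Λ, hΛ, w₀, n, r, hloc, c, hc, hwall⟩ := hAnchor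
  have hV : VertexVanishes D Λ := fun K hK hKD =>
    (parafermionPrecompact_iff_vanishing.1 hP) D Λ hΛ K hK hKD
  obtain ⟨h, hh0, hhr, hsmall⟩ :=
    hProp χ hχ hcr hBridge hUB D Λ hΛ (hStag D Λ hΛ) hV w₀ n r hloc (c / 2) (half_pos hc)
  have hbig := hwall χ hχ h hh0 hhr
  obtain ⟨δ, ⟨hle, hge⟩, hδpos⟩ := ((hsmall.and hbig).and self_mem_nhdsWithin).exists
  have hδ0 : (0:ℝ) < δ := hδpos
  have hpow : (0:ℝ) < δ ^ (-(2:ℝ) / 3) := Real.rpow_pos_of_pos hδ0 _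
  have key : c * δ ^ (-(2:ℝ) / 3) ≤ c / 2 * δ ^ (-(2:ℝ) / 3) := le_trans hge hle
  have key' : c ≤ c / 2 := le_of_mul_le_mul_right key hpow
  linarith

/-- **THE DELIVERABLE OF THE LINE: bulk non-degeneracy `H`.** From the six stubs, the Literature fact
`ParafermionBulkNondegenerate` (Duminil-Copin–Smirnov Conj. 8.7's weakest consequence: ONE admissible family of ONE
Dobrushin domain on which `δ^{-1/3} F_δ ↛ 0` on some compact) — the non-degeneracy input N of every SLE line of the
repaired crux, and the `H` of the negative-lemma hold on 11293 (`parafermionPrecompact_iff_not_bulkNondegenerate`). -/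
theorem bulkNondegenerate_of :
    VertexCornerBridge →
    (∃ χ : ℂ, (χ = Complex.I ∨ χ = -Complex.I) ∧ HalfCRVertexRelation χ) →
    UniformInnerEnvelope →
    (∀ (D : DobrushinDomain) (Λ : ℝ → DiscreteDobrushin), IsFamily D Λ → StaggeredVanishes D Λ) →
    AnchoredWallFlux →
    FluxPropagation →
    ParafermionBulkNondegenerate := by
  intro hBridge hCR hUB hStag hAnchor hProp
  by_contra hH
  exact false_of_stubs_of_parafermionPrecompact hBridge hCR hUB hStag hAnchor hProp
    (parafermionPrecompact_iff_not_bulkNondegenerate.2 hH)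

/-- **`ParafermionFamiliesToSLESix` from the six registered stubs — the skeleton theorem (concludes the crux BY NAME; no
`sorry` of its own, its only `sorryAx` uses sit inside the six `stub_*`).** The typed item is Disproof.lean's branch (ii)
(`crux_of_not_vanishing` / `crux_of_bulkNondegenerate`) with the lower bound PROVED from the stubs rather than assumed: the
second hypothesis `hP` is contradictory given S1–S6 (`false_of_stubs_of_parafermionPrecompact`), so the implication holds;
the conclusion of the crux is never inspected. -/
theorem ParafermionFamiliesToSLESix_of : ParafermionFamiliesToSLESix :=
  fun _hW hP =>
    (false_of_stubs_of_parafermionPrecompact stub_vertexCornerBridge stub_halfCRVertexRelation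
      stub_uniformInnerEnvelope stub_staggeredModeBound stub_anchoredWallFlux stub_fluxPropagation hP).elim

/-- And the line's deliverable from the registered stubs: `H` by name. -/
theorem bulkNondegenerate_of_stubs : ParafermionBulkNondegenerate :=
  bulkNondegenerate_of stub_vertexCornerBridge stub_halfCRVertexRelation stub_uniformInnerEnvelope
    stub_staggeredModeBound stub_anchoredWallFlux stub_fluxPropagation

/-! ## Checked algebra behind S6 (the exact decomposition of the axis-cut flux functionals) -/

/-- Horizontal pieces: `(1, −χ, 0, 0) = (1−χ)/4·𝟙 + ½·ν + (1+χ)/4·μ` componentwise, for EVERY `χ`. -/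
theorem flux_decomposition_horizontal (χ : ℂ) :
    (1 : ℂ) = (1 - χ) / 4 * 1 + 1 / 2 * 1 + (1 + χ) / 4 * 1 ∧
    (-χ : ℂ) = (1 - χ) / 4 * 1 + 1 / 2 * (-χ) + (1 + χ) / 4 * (-1) ∧
    (0 : ℂ) = (1 - χ) / 4 * 1 + 1 / 2 * (-1) + (1 + χ) / 4 * 1 ∧
    (0 : ℂ) = (1 - χ) / 4 * 1 + 1 / 2 * χ + (1 + χ) / 4 * (-1) := by
  refine ⟨by ring, by ring, by ring, by ring⟩

/-- Vertical pieces: `(0, −χ, −1, 0) = −(1+χ)/4·𝟙 + ½·ν + (χ−1)/4·μ` componentwise, for EVERY `χ`. -/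
theorem flux_decomposition_vertical (χ : ℂ) :
    (0 : ℂ) = -(1 + χ) / 4 * 1 + 1 / 2 * 1 + (χ - 1) / 4 * 1 ∧
    (-χ : ℂ) = -(1 + χ) / 4 * 1 + 1 / 2 * (-χ) + (χ - 1) / 4 * (-1) ∧
    (-1 : ℂ) = -(1 + χ) / 4 * 1 + 1 / 2 * (-1) + (χ - 1) / 4 * 1 ∧
    (0 : ℂ) = -(1 + χ) / 4 * 1 + 1 / 2 * χ + (χ - 1) / 4 * (-1) := by
  refine ⟨by ring, by ring, by ring, by ring⟩

/-- The staggered combination is invisible to neither axis functional: its weights `(1+χ)/4`, `(χ−1)/4` are non-zero for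
`χ = ±i` (so S4 is genuinely load-bearing, not decoration). -/
theorem stagger_weights_ne_zero (χ : ℂ) (hχ : χ = Complex.I ∨ χ = -Complex.I) :
    (1 + χ) / 4 ≠ 0 ∧ (χ - 1) / 4 ≠ 0 := by
  have hI : Complex.I ≠ 0 := Complex.I_ne_zero
  rcases hχ with rfl | rfl
  · constructor
    · intro h
      have h1 : (1 : ℂ) + Complex.I = 0 := by
        have := congrArg (· * 4) h
        simpa using this
      have := congrArg Complex.re h1
      simp at this
    · intro h
      have h1 : Complex.I - 1 = 0 := by
        have := congrArg (· * 4) h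
        simpa using this
      have := congrArg Complex.re h1
      simp at this
  · constructor
    · intro h
      have h1 : (1 : ℂ) + -Complex.I = 0 := by
        have := congrArg (· * 4) h
        simpa using this
      have := congrArg Complex.re h1
      simp at this
    · intro h
      have h1 : -Complex.I - 1 = 0 := by
        have := congrArg (· * 4) h
        simpa using this
      have := congrArg Complex.re h1
      simp at this

end

end Summit.CriticalPhenomena.CardyFormulaZ2.Cruxes.ParafermionFamiliesToSLESix.StripAnchoredVertexNormalisation
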